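import Mathlib.Analysis.Calculus.BumpFunction.FiniteDimension
import Mathlib.Analysis.SpecialFunctions.SmoothTransition
import Mathlib.Analysis.Distribution.SchwartzSpace.Basic
import HarnessLib

/-!
# Monotone exhaustion of an open set by smooth compactly supported (Schwartz) cut-offs

Topic `Analysis/Distribution`; namespace `Literature.Analysis.Distribution`. KERNEL MATHEMATICS ONLY:
no `def … : Prop` records, no `axiom`, no `sorry`.

Let `E` be a finite-dimensional real normed space and `U ⊆ E` an open set with compact closure. We
construct a sequence of smooth functions `φ_k : E → ℝ` (`k : ℕ`) with

* `0 ≤ φ_k ≤ 𝟙_U`, `tsupport φ_k ⊆ U` compact (so each `φ_k` is a test function, in particular a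
  Schwartz function — Mathlib `HasCompactSupport.toSchwartzMap`),
* `k ↦ φ_k x` monotone for every `x`,
* for every compact `K ⊆ U`, `φ_k = 1` on `K` for all large `k`,
* hence `φ_k x → 𝟙_U x` for every `x` (monotone pointwise convergence to the indicator).

This is the standard "smooth monotone exhaustion" used to pass from identities tested against smooth
(Schwartz) weights to identities on open sets / rectangles by monotone convergence (Hörmander,
Thm. 1.4.1 and the remark following it: cut-off functions equal to `1` on a compact subset of an
open set; an increasing sequence of them exhausting the open set).

Construction (no partition of unity needed): Mathlib's `IsOpen.exists_contDiff_support_eq` gives a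
smooth `f : E → [0, 1]` with `support f = U` exactly; put `φ_k := smoothTransition (k • f − 1)`
(`Real.smoothTransition` is smooth, monotone, `= 0` on `(-∞, 0]`, `= 1` on `[1, ∞)`). Then
`tsupport φ_k ⊆ {1 ≤ k f} ⊆ U`, `φ_k = 1` on `{2 ≤ k f}`, and a compact `K ⊆ U` lies in
`{2 ≤ k f}` as soon as `k ≥ 2 / min_K f`.

Main statements: `exists_contDiff_mono_tendsto_indicator` (functions) and
`exists_schwartzMap_mono_tendsto_indicator` (the same sequence as `𝓢(E, ℝ)`).

## References

* L. Hörmander, *The Analysis of Linear Partial Differential Operators I*, 2nd ed. (1990),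
  §1.4, Thm. 1.4.1 (smooth cut-off functions) [HormanderALPDO1].
* W. Rudin, *Real and Complex Analysis*, 3rd ed. (1987), Lemma 2.12 (Urysohn) and Thm. 2.14
  [Rudin1987].
-/

noncomputable section

open Filter Set Function
open scoped Topology SchwartzMap ContDiff

namespace Literature.Analysis.Distribution

variable {E : Type*} [NormedAddCommGroup E] [NormedSpace ℝ E] [FiniteDimensional ℝ E]

/-- **Smooth monotone exhaustion of an open set with compact closure.** For `U ⊆ E` open with
`closure U` compact there are smooth `φ_k : E → ℝ`, compactly supported with `tsupport φ_k ⊆ U`,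
`0 ≤ φ_k ≤ 1`, `φ_k ≤ 𝟙_U`, monotone in `k`, eventually equal to `1` on every compact `K ⊆ U`, and
converging pointwise to `𝟙_U`. [cite: HormanderALPDO1, Thm. 1.4.1] -/
theorem exists_contDiff_mono_tendsto_indicator {U : Set E} (hU : IsOpen U)
    (hUc : IsCompact (closure U)) :
    ∃ φ : ℕ → E → ℝ,
      (∀ k, ContDiff ℝ ∞ (φ k)) ∧
      (∀ k, HasCompactSupport (φ k)) ∧
      (∀ k, tsupport (φ k) ⊆ U) ∧
      (∀ k x, 0 ≤ φ k x) ∧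
      (∀ k x, φ k x ≤ 1) ∧
      (∀ k x, φ k x ≤ U.indicator 1 x) ∧
      (∀ x, Monotone fun k => φ k x) ∧
      (∀ K ⊆ U, IsCompact K → ∀ᶠ k in atTop, ∀ x ∈ K, φ k x = 1) ∧
      (∀ x, Tendsto (fun k => φ k x) atTop (𝓝 (U.indicator 1 x))) := by
  obtain ⟨f, hfs, hfd, hfr⟩ := hU.exists_contDiff_support_eq (n := (⊤ : ℕ∞))
  have hf0 : ∀ x, 0 ≤ f x := fun x => (hfr ⟨x, rfl⟩).1
  set φ : ℕ → E → ℝ := fun k x => Real.smoothTransition ((k : ℝ) * f x - 1) with hφ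
  -- support control: `tsupport φ_k ⊆ {1 ≤ k f} ⊆ U`
  have hsupp : ∀ k, tsupport (φ k) ⊆ {x | 1 ≤ (k : ℝ) * f x} := fun k => by
    refine closure_minimal (fun x hx => ?_)
      (isClosed_le continuous_const (continuous_const.mul hfd.continuous))
    rw [mem_support] at hx
    by_contra h
    simp only [mem_setOf_eq, not_le] at h
    exact hx (Real.smoothTransition.zero_of_nonpos (by linarith))
  have hsub : ∀ k, {x | 1 ≤ (k : ℝ) * f x} ⊆ U := fun k x hx => by
    rw [← hfs, mem_support]
    intro h0
    simp only [mem_setOf_eq, h0, mul_zero] at hx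
    linarith
  have htU : ∀ k, tsupport (φ k) ⊆ U := fun k => (hsupp k).trans (hsub k)
  -- eventually `= 1` on compact subsets of `U`
  have hone : ∀ K ⊆ U, IsCompact K → ∀ᶠ k in atTop, ∀ x ∈ K, φ k x = 1 := by
    intro K hKU hK
    rcases K.eq_empty_or_nonempty with rfl | hKne
    · exact Eventually.of_forall fun k x hx => hx.elim
    obtain ⟨x₀, hx₀K, hx₀⟩ := hK.exists_isMinOn hKne hfd.continuous.continuousOn
    have hm : 0 < f x₀ := by
      refine lt_of_le_of_ne (hf0 x₀) fun h => ?_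
      have : x₀ ∈ support f := by rw [hfs]; exact hKU hx₀K
      exact this h.symm
    obtain ⟨N, hN⟩ := exists_nat_ge (2 / f x₀)
    refine eventually_atTop.mpr ⟨N, fun k hk x hx => Real.smoothTransition.one_of_one_le ?_⟩
    have h1 : f x₀ ≤ f x := (isMinOn_iff.mp hx₀) x hx
    have h2 : 2 / f x₀ ≤ (k : ℝ) := hN.trans (Nat.cast_le.mpr hk)
    have h3 : 2 ≤ (k : ℝ) * f x₀ := by rwa [div_le_iff₀ hm] at h2
    have h4 : (k : ℝ) * f x₀ ≤ (k : ℝ) * f x := mul_le_mul_of_nonneg_left h1 (Nat.cast_nonneg k)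
    linarith
  refine ⟨φ, fun k => ?_, fun k => ?_, htU, fun k x => Real.smoothTransition.nonneg _,
    fun k x => Real.smoothTransition.le_one _, fun k x => ?_, fun x => ?_, hone, fun x => ?_⟩
  · -- smooth
    exact Real.smoothTransition.contDiff.comp ((contDiff_const.mul hfd).sub contDiff_const)
  · -- compact support
    exact hUc.of_isClosed_subset (isClosed_tsupport _) ((htU k).trans subset_closure)
  · -- `≤ 𝟙_U`
    by_cases hx : x ∈ U
    · simp only [indicator_of_mem hx, Pi.one_apply]
      exact Real.smoothTransition.le_one _
    · have : φ k x = 0 := image_eq_zero_of_notMem_tsupport fun h => hx (htU k h)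
      simp only [indicator_of_notMem hx, this, le_refl]
  · -- monotone in `k`
    intro k l hkl
    refine Real.smoothTransition.monotone (sub_le_sub_right ?_ 1)
    exact mul_le_mul_of_nonneg_right (Nat.cast_le.mpr hkl) (hf0 x)
  · -- pointwise convergence to the indicator
    by_cases hx : x ∈ U
    · have hev : ∀ᶠ k in atTop, φ k x = 1 :=
        (hone {x} (singleton_subset_iff.mpr hx) isCompact_singleton).mono fun k hk =>
          hk x (mem_singleton x)
      simp only [indicator_of_mem hx, Pi.one_apply]
      exact tendsto_const_nhds.congr' (hev.mono fun k hk => hk.symm)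
    · have h0 : ∀ k, φ k x = 0 := fun k =>
        image_eq_zero_of_notMem_tsupport fun h => hx (htU k h)
      simp only [indicator_of_notMem hx, h0]
      exact tendsto_const_nhds

/-- **Schwartz form of the smooth monotone exhaustion.** For `U ⊆ E` open with compact closure there
are Schwartz functions `φ_k ∈ 𝓢(E, ℝ)`, compactly supported with `tsupport φ_k ⊆ U`, `0 ≤ φ_k ≤ 1`,
`φ_k ≤ 𝟙_U`, monotone in `k`, eventually `1` on every compact `K ⊆ U`, with `φ_k x → 𝟙_U x` for
every `x`. [cite: HormanderALPDO1, Thm. 1.4.1] -/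
theorem exists_schwartzMap_mono_tendsto_indicator {U : Set E} (hU : IsOpen U)
    (hUc : IsCompact (closure U)) :
    ∃ φ : ℕ → 𝓢(E, ℝ),
      (∀ k, HasCompactSupport (φ k)) ∧
      (∀ k, tsupport (φ k) ⊆ U) ∧
      (∀ k x, 0 ≤ φ k x) ∧
      (∀ k x, φ k x ≤ 1) ∧
      (∀ k x, φ k x ≤ U.indicator 1 x) ∧
      (∀ x, Monotone fun k => φ k x) ∧
      (∀ K ⊆ U, IsCompact K → ∀ᶠ k in atTop, ∀ x ∈ K, φ k x = 1) ∧
      (∀ x, Tendsto (fun k => φ k x) atTop (𝓝 (U.indicator 1 x))) := by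
  obtain ⟨φ, hd, hc, hs, h0, h1, hU1, hm, hK, ht⟩ := exists_contDiff_mono_tendsto_indicator hU hUc
  refine ⟨fun k => (hc k).toSchwartzMap (hd k), hc, hs, h0, h1, hU1, hm, hK, ht⟩

/-- **Monotone exhaustion by smooth cut-offs, plain-function corollary with the limit as a supremum.**
Under the same hypotheses, `𝟙_U x = ⨆ k, φ_k x` for the sequence of
`exists_contDiff_mono_tendsto_indicator`. [cite: HormanderALPDO1, Thm. 1.4.1] -/
theorem exists_contDiff_iSup_eq_indicator {U : Set E} (hU : IsOpen U)
    (hUc : IsCompact (closure U)) :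
    ∃ φ : ℕ → E → ℝ,
      (∀ k, ContDiff ℝ ∞ (φ k)) ∧
      (∀ k, HasCompactSupport (φ k)) ∧
      (∀ k, tsupport (φ k) ⊆ U) ∧
      (∀ k x, 0 ≤ φ k x) ∧
      (∀ x, Monotone fun k => φ k x) ∧
      (∀ x, ⨆ k, φ k x = U.indicator 1 x) := by
  obtain ⟨φ, hd, hc, hs, h0, -, hU1, hm, -, ht⟩ := exists_contDiff_mono_tendsto_indicator hU hUc
  refine ⟨φ, hd, hc, hs, h0, hm, fun x => ?_⟩
  exact tendsto_nhds_unique (tendsto_atTop_ciSup (hm x) ⟨U.indicator 1 x, by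
    rintro _ ⟨k, rfl⟩; exact hU1 k x⟩) (ht x)

end Literature.Analysis.Distribution
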